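import Literature.Computability.Complexity.HamCircuitNP
import Literature.Computability.Complexity.FoldCatBricks

set_option linter.dupNamespace false

/-!
# Stub T1 `stub_graphCanon` of the line `SketchIdeator1` for crux stmt-PneNP-2717
`Summit.PneNP.PneNP.Theses.PhaseTwins.NoFBPPApproxAboveUniqueness`

The re-encoding `w ↦ encode (decode w)` of the tree's graph code `encodingGraph`
(`GraphEncodings.lean`: `⟨encodeNat n, n² row-major adjacency bits⟩`; the decoder reads the numeral
field with Mathlib's total `decodeNat`, tests that the bit field has `n²` symbols, and reads an arbitrary
bit matrix as `SimpleGraph.fromRel`, i.e. symmetrised with the diagonal removed) is polynomial time;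
words whose bit field has the wrong length (the only undecodable ones) are sent to the fixed
non-code-word `⟨encodeNat 1, ε⟩`. This is the canonicalisation bridge of `CanonicalCodes.lean` for graph
codes: a counting function defined through `decode` (here the hard-core count `hardcoreCount`,
`HardcoreInapproximability.lean`) factors as `Φ ∘ (encode ∘ decode)` with `Φ` reading code words only.

Brick assembly in the `FP` string algebra (no machine is written, no definition is introduced): the
word `w = ⟨a, b⟩` is re-paired as the `CLIQUE` instance record `x = ⟨⟨canonF a, b⟩, ε⟩` of
`KarpCliqueNP.lean` (`Brick.canonF a = encodeNat (decodeNat a)`, `FoldBricks.lean`), on which the header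
test `CliqueNP.hdrT` decides `|b| = n²` and the accessors `CliqueNP.sB`, `CliqueNP.sBT`, `CliqueNP.sEq`
read, on `⟨x, 1ᵗ⟩`, the bit `b[t]`, the transposed bit `b[(t % n) n + t / n]` and the diagonal test
`[t / n = t % n]`; the one-bit piece `[t / n ≠ t % n ∧ (b[t] ∨ b[(t % n) n + t / n])]` is concatenated
over `t < |b| = n²` by the fold `Brick.foldCat` (`FoldCatBricks.lean`), and `iteFn` selects between
`⟨canonF a, matrix⟩` and the constant.

## References

* S. Arora, B. Barak, *Computational Complexity: A Modern Approach*, CUP 2009, §0.1 (adjacency-matrix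
  codes of graphs), §1.3 (polynomial time is closed under composition and bounded loops).
-/

namespace Summit.PneNP.PneNP.Theorems.NoFBPPApproxAboveUniqueness

open Literature.Computability.Complexity _root_.Computability Polynomial Brick Plumb OracleCompose HashBricks

/-- A concatenation of one-symbol pieces is `List.ofFn` of the symbols. [folklore] -/
private theorem ccat_singleton_eq_ofFn (β : ℕ → Bool) :
    ∀ k : ℕ, ccat (fun t => [β t]) k = List.ofFn fun t : Fin k => β t
  | 0 => rfl
  | k + 1 => by
    rw [ccat_succ, ccat_singleton_eq_ofFn β k, List.ofFn_succ', List.concat_eq_append]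
    rfl

/-- **The symmetrised bit matrix is the adjacency code of the decoded graph**: for `|b| = n²`, the bits
`[t / n ≠ t % n ∧ (b[t] ∨ b[(t % n) n + t / n])]`, `t < n²`, are `CliqueNP.adjBits` of
`SimpleGraph.fromRel (i j ↦ b[finProdFinEquiv (i, j)])` (the graph `encodingGraphFin n` decodes `b` to).
[cite: AroraBarak2009, §0.1 (adjacency-matrix representation)] -/
private theorem ccat_eq_adjBits {n : ℕ} {b : List Bool} (h : b.length = n * n) :
    ccat (fun t => [(!decide (t / n = t % n)) && (b.getD t false || b.getD (t % n * n + t / n) false)])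
        b.length =
      CliqueNP.adjBits n (SimpleGraph.fromRel fun i j : Fin n =>
        b.get ((finProdFinEquiv (i, j)).cast h.symm) = true) := by
  have hget : ∀ k : Fin (n * n), b.get (k.cast h.symm) = b.getD k false := fun k =>
    (List.getD_eq_get b false (k.cast h.symm)).symm
  rw [ccat_singleton_eq_ofFn]
  unfold CliqueNP.adjBits
  refine List.ext_getElem (by simp [h]) fun i h1 h2 => ?_
  have hc : i / n + n * (i % n) = i % n * n + i / n := by ring
  simp only [List.getElem_ofFn]
  rw [Bool.eq_iff_iff, @decide_eq_true_iff _ (Classical.propDecidable _)]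
  simp only [SimpleGraph.fromRel_adj, hget, finProdFinEquiv_apply_val, Fin.coe_divNat, Fin.coe_modNat,
    Nat.mod_add_div, hc, Ne, Fin.ext_iff, Bool.and_eq_true, Bool.or_eq_true, Bool.not_eq_true',
    decide_eq_false_iff_not]

/-- The accessors of `KarpCliqueNP.lean` on `⟨x, 1ᵗ⟩` for a record `x` whose dimension `N` fits in the
ruler (`N ≤ |x|`): the symmetrising piece reads `[t / N ≠ t % N ∧ (bits[t] ∨ bits[(t % N) N + t / N])]`
(as in `CliqueNP.symPiece_apply`). [folklore] -/
private theorem piece_apply' {x : List Bool} (hN : CliqueNP.dimOf x ≤ x.length) (t : ℕ) :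
    andFn (notFn CliqueNP.sEq) (orFn CliqueNP.sB CliqueNP.sBT) (boolPair x (ones t)) =
      [(!decide (t / CliqueNP.dimOf x = t % CliqueNP.dimOf x)) &&
        ((CliqueNP.bitsF x).getD t false ||
          (CliqueNP.bitsF x).getD (t % CliqueNP.dimOf x * CliqueNP.dimOf x + t / CliqueNP.dimOf x) false)] := by
  have hN' : bitsToNat (CliqueNP.ncF x) ≤ x.length := hN
  have hsN : CliqueNP.sN (boolPair x (ones t)) = ones (CliqueNP.dimOf x) := by
    rw [CliqueNP.sN, Function.comp_apply, fanoutFn_apply, fstF_boolPair, Function.comp_apply, fstF_boolPair,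
      binToUnaryFn_boolPair, min_eq_left hN']
    rfl
  have hij : CliqueNP.sIJ (boolPair x (ones t)) =
      boolPair (ones (t / CliqueNP.dimOf x)) (ones (t % CliqueNP.dimOf x)) := by
    rw [CliqueNP.sIJ, Function.comp_apply, fanoutFn_apply, hsN, sndF_boolPair, divModFn_boolPair]
  have hB : CliqueNP.sB (boolPair x (ones t)) = [(CliqueNP.bitsF x).getD t false] := by
    rw [CliqueNP.sB, Function.comp_apply, Function.comp_apply, fanoutFn_apply, sndF_boolPair,
      Function.comp_apply, fstF_boolPair, bitAtFn_boolPair, headBitFn_apply, List.length_replicate,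
      CliqueNP.headD_take_one_drop]
  have hTT : CliqueNP.sTT (boolPair x (ones t)) =
      ones (t % CliqueNP.dimOf x * CliqueNP.dimOf x + t / CliqueNP.dimOf x) := by
    rw [CliqueNP.sTT, Function.comp_apply, fanoutFn_apply, Function.comp_apply, fanoutFn_apply,
      Function.comp_apply, hij, sndF_boolPair, hsN, umulFn_boolPair, Function.comp_apply, hij, fstF_boolPair,
      appF_boolPair, List.replicate_append_replicate]
  have hBT : CliqueNP.sBT (boolPair x (ones t)) =
      [(CliqueNP.bitsF x).getD (t % CliqueNP.dimOf x * CliqueNP.dimOf x + t / CliqueNP.dimOf x) false] := by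
    rw [CliqueNP.sBT, Function.comp_apply, Function.comp_apply, fanoutFn_apply, hTT, Function.comp_apply,
      fstF_boolPair, bitAtFn_boolPair, headBitFn_apply, List.length_replicate, CliqueNP.headD_take_one_drop]
  have hEq : CliqueNP.sEq (boolPair x (ones t)) = [decide (t / CliqueNP.dimOf x = t % CliqueNP.dimOf x)] := by
    rw [CliqueNP.sEq, Function.comp_apply, hij, eqPairFn_boolPair]
    simp only [CliqueNP.ones_inj]
  rw [andFn_apply (notFn_apply hEq) (orFn_apply hB hBT)]

/-- The symmetrising piece on `⟨⟨⟨encodeNat n, b⟩, ε⟩, 1ᵗ⟩` with `|b| = n²`: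
`[t / n ≠ t % n ∧ (b[t] ∨ b[(t % n) n + t / n])]`. [folklore] -/
private theorem piece_apply {n : ℕ} {b : List Bool} (h : b.length = n * n) (t : ℕ) :
    andFn (notFn CliqueNP.sEq) (orFn CliqueNP.sB CliqueNP.sBT)
        (boolPair (boolPair (boolPair (encodeNat n) b) []) (ones t)) =
      [(!decide (t / n = t % n)) && (b.getD t false || b.getD (t % n * n + t / n) false)] := by
  have hb : CliqueNP.bitsF (boolPair (boolPair (encodeNat n) b) []) = b := by simp [CliqueNP.bitsF]
  have hd : CliqueNP.dimOf (boolPair (boolPair (encodeNat n) b) []) = n := by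
    simp [CliqueNP.dimOf, CliqueNP.ncF]
  have hN : CliqueNP.dimOf (boolPair (boolPair (encodeNat n) b) []) ≤
      (boolPair (boolPair (encodeNat n) b) []).length :=
    CliqueNP.dimOf_le_length (by rw [hb, hd]; exact h)
  rw [piece_apply' hN, hb, hd]

/-- The header test of `KarpCliqueNP.lean` on `⟨⟨encodeNat n, b⟩, ε⟩`: `[|b| = n²]`. [folklore] -/
private theorem hdrT_rec (n : ℕ) (b : List Bool) :
    CliqueNP.hdrT (boolPair (boolPair (encodeNat n) b) []) = [decide (b.length = n * n)] := by
  have hb : CliqueNP.bitsF (boolPair (boolPair (encodeNat n) b) []) = b := by simp [CliqueNP.bitsF]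
  have hd : CliqueNP.dimOf (boolPair (boolPair (encodeNat n) b) []) = n := by
    simp [CliqueNP.dimOf, CliqueNP.ncF]
  rw [CliqueNP.hdrT_apply, hb, hd]

/-- **Stub T1 (graph-code canonicalisation).** The re-encoding `w ↦ encode (decode w)` of the tree's graph
code (`encodingGraph`: `⟨encodeNat n, n² row-major adjacency bits⟩`, decoded to `SimpleGraph.fromRel`,
i.e. symmetrised with the diagonal removed; undecodable words — adjacency field of the wrong length — are
sent to the fixed non-code-word `⟨encodeNat 1, ε⟩`) is polynomial time (brick assembly: `canonF` for the
numeral, the header test `CliqueNP.hdrT` for the length test, a `foldCat` over the `n²` flat indices writing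
`[i ≠ j ∧ (b[in+j] ∨ b[jn+i])]`). [cite: AroraBarak2009, §0.1 (adjacency-matrix representation), §1.3 (bounded loops)] -/
theorem stub_graphCanon :
    ∃ cg ∈ FP, ∀ w : List Bool,
      cg w = (match encodingGraph.decode w with
        | none => boolPair (encodeNat 1) []
        | some G => encodingGraph.encode G) := by
  -- the pieces: the symmetrising piece, the canonical numeral `encodeNat n` (`n = decodeNat a`), the
  -- `CLIQUE`-format record `x = ⟨⟨encodeNat n, b⟩, ε⟩`, the bit matrix (a `foldCat` of the piece over
  -- `t < |b|`), and the branch on the header test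
  set gp : List Bool → List Bool := andFn (notFn CliqueNP.sEq) (orFn CliqueNP.sB CliqueNP.sBT) with hgp
  set ncF' : List Bool → List Bool := canonF ∘ fstF with hncF'
  set xF : List Bool → List Bool := fanoutFn (fanoutFn ncF' sndF) (fun _ => []) with hxF
  set matF : List Bool → List Bool := foldCat 1 X gp ∘ fanoutFn xF sndF with hmatF
  have hgpFP : gp ∈ FP :=
    andFn_mem_FP (notFn_mem_FP CliqueNP.sEq_mem_FP) (orFn_mem_FP CliqueNP.sB_mem_FP CliqueNP.sBT_mem_FP)
  have hgp1 : OneBit gp :=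
    oneBit_andFn (oneBit_notFn CliqueNP.oneBit_sEq) (oneBit_orFn CliqueNP.oneBit_sB CliqueNP.oneBit_sBT)
  have hncFP : ncF' ∈ FP := comp_mem_FP canonF_mem_FP fstF_mem_FP
  have hxFP : xF ∈ FP := fanoutFn_mem_FP (fanoutFn_mem_FP hncFP sndF_mem_FP) (const_mem_FP _)
  have hmatFP : matF ∈ FP := comp_mem_FP (foldCat_mem_FP 1 X hgpFP) (fanoutFn_mem_FP hxFP sndF_mem_FP)
  refine ⟨iteFn (CliqueNP.hdrT ∘ xF) (fanoutFn ncF' matF) fun _ => boolPair (encodeNat 1) [],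
    iteFn_mem_FP (comp_mem_FP CliqueNP.hdrT_mem_FP hxFP) (fanoutFn_mem_FP hncFP hmatFP) (const_mem_FP _),
    fun w => ?_⟩
  -- the decoder, unfolded: `n = decodeNat a`, length test on `b`, then `fromRel` of the bit matrix
  have hdec : encodingGraph.decode w =
      ((if h : (sndF w).length = decodeNat (fstF w) * decodeNat (fstF w) then
          some (fun i => (sndF w).get (i.cast h.symm)) else none).map
        fun f => SimpleGraph.fromRel fun i j : Fin (decodeNat (fstF w)) =>
          f (finProdFinEquiv (i, j)) = true).map (Sigma.mk (decodeNat (fstF w))) := rfl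
  have hnc : ncF' w = encodeNat (decodeNat (fstF w)) := by
    simp only [hncF', Function.comp_apply, canonF_eq_encodeNat_decodeNat]
  have hx : xF w = boolPair (boolPair (encodeNat (decodeNat (fstF w))) (sndF w)) [] := by
    simp only [hxF, fanoutFn_apply, hnc]
  have htest : (CliqueNP.hdrT ∘ xF) w =
      [decide ((sndF w).length = decodeNat (fstF w) * decodeNat (fstF w))] := by
    rw [Function.comp_apply, hx, hdrT_rec]
  rw [hdec]
  by_cases h : (sndF w).length = decodeNat (fstF w) * decodeNat (fstF w)
  · -- a decodable word: re-encode `⟨n, fromRel (bit matrix)⟩`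
    simp only [dif_pos h, Option.map_some]
    have hpieces : ∀ t, t < (sndF w).length → gp (boolPair (xF w) (ones t)) =
        [(!decide (t / decodeNat (fstF w) = t % decodeNat (fstF w))) &&
          ((sndF w).getD t false ||
            (sndF w).getD (t % decodeNat (fstF w) * decodeNat (fstF w) + t / decodeNat (fstF w)) false)] :=
      fun t _ => by rw [hx, hgp, piece_apply h]
    -- `|b| ≤ |x|` rounds are available
    have hk : (sndF w).length ≤ (X : Polynomial ℕ).eval (xF w).length := by
      rw [eval_X, hx, length_boolPair, length_boolPair]
      omega
    -- the pieces are single symbols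
    have hQ : ∀ t, t < (sndF w).length →
        (gp (boolPair (xF w) (ones t))).length ≤ (1 : Polynomial ℕ).eval (xF w).length := fun t _ => by
      rw [eval_one, hgp1.length_eq]
    rw [iteFn_apply_true (by rw [htest, decide_eq_true h]), fanoutFn_apply, HamNP.encode_eq, hnc, hmatF,
      Function.comp_apply, fanoutFn_apply, foldCat_apply hk hQ, ccat_congr hpieces, ccat_eq_adjBits h]
  · -- bit field of the wrong length: the constant non-code-word
    simp only [dif_neg h, Option.map_none]
    rw [iteFn_apply_false (by rw [htest, decide_eq_false h])]

end Summit.PneNP.PneNP.Theorems.NoFBPPApproxAboveUniqueness
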